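import Mathlib
import HarnessLib
import Summits.FinalStateConjecture.Statement
import Summits.FinalStateConjecture.FinalStateConjecture.Theorems.BurnettKineticRigidityAssemblyT2

/-!
# Route BurnettKineticRigidity — the Assembly, frame form (item stmt-FinalStateConjecture-9991)

The assembly item of route `BurnettKineticRigidity` for the Final State Conjecture is

`SettlesOutsidePhotonRegions → PhotonRegionThresholdCodim → CensorshipViolationCodim → MGHDExistence →
FinalStateConjecture`

with A = `SettlesOutsidePhotonRegions` (censored dichotomy: every maximal vacuum Cauchy development of
an admissible datum with complete `𝓘⁺` either settles — exhaustive `C²` decomposition into finitely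
many sub-extremal Kerrs plus radiation — or carries a photon-region remnant, a late chart on a Kerr
exterior `(M, a)`, `0 < M`, `|a| ≤ M`, on which the metric `C²`-converges on every annular slab
`{t* = τ, ρ ≤ r ≤ R}`), B_S = `PhotonRegionThresholdCodim` (through every admissible datum owning a
complete, remnant-carrying, non-settling MGHD passes a jointly smooth injective admissible curve all
of whose other members have only complete MGHDs on which remnant ⇒ settles), B_W =
`CensorshipViolationCodim` (the same escape through every admissible datum owning an MGHD with
incomplete `𝓘⁺`) and S = `MGHDExistence` (Choquet-Bruhat–Geroch on the admissible class).

Design constraint (why this file does NOT import the route module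
`Summits.FinalStateConjecture.FinalStateConjecture.Theses.BurnettKineticRigidity`): when an item
closes, the gate re-renders the route file with `import <closing module>` and
`theorem Assembly_holds : Assembly := …`; a closing module that itself imports the route module
turns that render into an import cycle (the EIHFluxBalance rev-3 and PhotonSphereChannels rev-3/4/6
episodes of this summit). So the theorem below states the four hypotheses INLINED VERBATIM (the
bodies of `SettlesOutsidePhotonRegions`, `PhotonRegionThresholdCodim`, `CensorshipViolationCodim`
and `MGHDExistence`, copied from the route file rev 5, one physical line each, elaborated under the
route file's `open` lines), so that its type is the route decl
`Summit.FinalStateConjecture.FinalStateConjecture.Theses.BurnettKineticRigidity.Assembly` by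
`δ`-unfolding alone, and the route file can import this module without a cycle (pattern of
`Theorems/EIHFluxBalanceAssemblyFrame.lean`, `Theorems/PhotonSphereChannelsAssemblyFrameR.lean`).

The proof is pure classical logic, the body of the route's deciding theorem `closes` (whose idle
hypothesis `_hAsm : Assembly` is dropped): fix `X` and an admissible datum `d` failing the
conjecture's property `P`. By S an MGHD of `d` exists, so — `P d` failing — some MGHD of `d` has
incomplete `𝓘⁺`, or every MGHD is complete and some complete MGHD does not settle. In the first
case B_W gives the escaping curve `F`; otherwise A gives a remnant on the non-settling MGHD and B_S
gives `F`. For `c ≠ 0`, `F c` is admissible, has an MGHD (S), and every MGHD of it is complete with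
remnant ⇒ settles (escape clause) and settles ∨ remnant (A), hence settles: `P (F c)`. So the
exceptional set of `P` has Christodoulou codimension `≥ 1` in the admissible class, which is
`FinalStateConjecture`. No analysis, no new definitions; nothing here bears on the truth of A, B_S,
B_W or S (three open problems and the Choquet-Bruhat–Geroch theorem).

## Dependency drift (2026-08-17 repair of a fullbuild breakage)

The summit statement `_root_.FinalStateConjecture` was RE-TYPED on 2026-08-16 (T2:
`IsTameChristodoulouGeneric` with an `AFEnd` witness, `RaysStayInClosure` / `IsFutureOriented`), and the
route was re-rendered accordingly (rev 8). The landed theorem of this file (p101300) kept elaborating as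
a STATEMENT — rev-5 item bodies inlined as hypotheses, conclusion the re-typed conjecture — but its
classical-logic proof broke (the rev-5 escape clauses produce `IsSmoothDataFamily` curves and the rev-5
settled clause, not the T2 generic-set witnesses), and no proof of that mixed statement is known or
expected: it is not the route's assembly any more. The re-typed frame theorem was landed separately as
`BurnettKineticRigidity.assemblyT2_frame_proof` (`Theorems/BurnettKineticRigidityAssemblyT2.lean`,
p132472; rev-8 bodies verbatim, closing the reopened item stmt-FinalStateConjecture-9991). Under the
append-only rule ("deprecate, don't mutate") the rev-5 name is therefore kept here as a DEPRECATED ALIAS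
of that successor; the rev-5 statement and proof text survive in the ledger record of p101300. This
module imports only `Statement` and the successor module (itself route-module-free), so the no-cycle
design constraint above still holds.
-/

-- `Summit.FinalStateConjecture.FinalStateConjecture.…`: summit = sub-problem name (D-0017), as in every file here;
-- the Summits library sets `weak.linter.dupNamespace = false`, repeated for standalone elaboration (`lean check`).
set_option linter.dupNamespace false

namespace Summit.FinalStateConjecture.FinalStateConjecture.Theorems

/-- **Assembly of route BurnettKineticRigidity, frame form — rev-5 name, DEPRECATED.** Landed (p101300)
as the rev-5 frame `A → B_S → B_W → S → FinalStateConjecture` with the rev-5 bodies of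
`SettlesOutsidePhotonRegions`, `PhotonRegionThresholdCodim`, `CensorshipViolationCodim`, `MGHDExistence`
inlined; after the T2 re-type of `_root_.FinalStateConjecture` (2026-08-16) that mixed statement no longer
follows by logic and is not the route's assembly. The live frame theorem (rev-8 bodies, same classical
case split: an exceptional admissible datum has an MGHD (S), hence is censorship-violating or — by A —
photon-region-threshold; B_W resp. B_S supply the escaping family) is
`BurnettKineticRigidity.assemblyT2_frame_proof`, of which this name is now an alias.
[cite: Christodoulou1999, p. A24] [cite: DafermosLuk2017, Conjecture 1] -/
@[deprecated BurnettKineticRigidity.assemblyT2_frame_proof (since := "2026-08-17")]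
alias BurnettKineticRigidity.assembly_proof := BurnettKineticRigidity.assemblyT2_frame_proof

/-- **The classical skeleton of the frame argument** (the `hesc` step shared verbatim by the rev-5 proof
of p101300 and the rev-8 proof `BurnettKineticRigidity.assemblyT2_frame_proof`, with the geometry
abstracted away): data `d : Δ`, developments `m : M d` (read: maximal Cauchy developments), predicates
`Complete` (complete `𝓘⁺`), `Settles`, `Remnant` (photon-region remnant) on developments, `Adm`
(admissible) and `Esc` (an escaping Christodoulou family exists) on data. If (A) every complete
development of an admissible datum settles or carries a remnant, (B_S) every admissible datum owning a
complete, remnant-carrying, non-settling development escapes, (B_W) every admissible datum owning an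
incomplete development escapes, and (S) every admissible datum has a development, then every admissible
datum failing "has a development, and all developments are complete and settle" escapes. Pure logic (one
`by_cases` on the existence of an incomplete development); recorded so that the next re-type of the
settled clause only has to re-instantiate it. [folklore] -/
theorem BurnettKineticRigidity.frame_skeleton {Δ : Type*} {M : Δ → Type*} {Adm Esc : Δ → Prop}
    {Complete Settles Remnant : ∀ d, M d → Prop}
    (hA : ∀ d, Adm d → ∀ m : M d, Complete d m → Settles d m ∨ Remnant d m)
    (hS : ∀ d, Adm d → (∃ m : M d, Complete d m ∧ Remnant d m ∧ ¬ Settles d m) → Esc d)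
    (hW : ∀ d, Adm d → (∃ m : M d, ¬ Complete d m) → Esc d)
    (hE : ∀ d, Adm d → Nonempty (M d)) :
    ∀ d, Adm d → ¬ (Nonempty (M d) ∧ ∀ m : M d, Complete d m ∧ Settles d m) → Esc d := by
  intro d hdA hnP
  by_cases hc : ∃ m : M d, ¬ Complete d m
  · -- a censorship-violating datum: B_W
    exact hW d hdA hc
  · -- every development is complete; `d` being exceptional, some development does not settle, and A
    -- puts a remnant on it: B_S
    have hc' : ∀ m : M d, Complete d m := fun m ↦ by_contra fun hn ↦ hc ⟨m, hn⟩
    apply hS d hdA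
    by_contra hno
    apply hnP
    refine ⟨hE d hdA, fun m ↦ ⟨hc' m, ?_⟩⟩
    rcases hA d hdA m (hc' m) with hset | hrem
    · exact hset
    · by_contra hns
      exact hno ⟨m, hc' m, hrem, hns⟩

end Summit.FinalStateConjecture.FinalStateConjecture.Theorems
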